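import Summits.Ventures.PercRepro.Night2FatXMass
import Summits.Ventures.PercRepro.Night2BasisLevels

/-!
# night-2: the fat case of the basis pairs' fair share when no target above `Q ∪ {x}` is loaded

With the fat split `G ∖ clF B₀ = {w₀, x}` of a lossy basis pair and NO loaded target above `Q ∪ {x}`, the
binomial criterion of `basis_pair_fair_of_fat_count_sum` holds outright: the targets above `Q ∪ {x}` at level `j`
number at least `C(N − 1, j − 1)` (`N = |G ∖ Q| ≥ 4`), each contributes `capS T / ((221/360) · 2 · C(j + 3, 4))`
with `capS ≥ 11/18`, and `capS = 1` at the top four levels (`fat_count_level_ge`); the first three levels already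
give `110/221 + 6 · 22/221 > 1` for `N ≥ 7`, `880/663` at `N = 6`, `326/221` at `N = 5`, `324/221` at `N = 4`
(`fat_count_sum_ge_one_of_unloaded`).  Hence **`basis_pair_fair_fat_of_unloaded`**: the fair share of every lossy
basis pair of the fat case whose targets above `Q ∪ {x}` carry no `dshGT2` load.  Paper `proofs/NIGHT-2-g32.md`
§3.5.
-/

namespace PercRepro.Shadow

open PercRepro.ThmH PercRepro.PerFlat

variable {α : Type*} [DecidableEq α] {M : Matroid α} [M.Finite] {G : Finset α}

/-- The level-`j` term of the fat count criterion with capacity `c`. -/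
noncomputable def fatTerm (j : ℕ) (c : ℚ) : ℚ := c / ((221 / 360 : ℚ) * ((2 * (j + 3).choose 4 : ℕ) : ℚ))

/-- A basis pair has at least four points of `G` off `Q` (`|G ∖ B| ≥ 5`). -/
theorem four_le_card_sdiff_insert (hG : G ∈ flatsQ M (5 + 1)) (hd : (gr M \ G).card = 2)
    {B : Finset α} (hB : B ∈ thinMembers M 5 G) {z : α} (hz : z ∈ G \ clF M B) :
    4 ≤ (G \ insert z B).card := by
  have h5 := five_le_card_sdiff_of_mem_thinMembers hG hd hB
  have hzG : z ∈ G := (Finset.mem_sdiff.1 hz).1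
  have hzB : z ∉ B := fun h => (Finset.mem_sdiff.1 hz).2 (subset_clF_of_subset_gr
    ((subset_G_of_mem_thinMembers hB).trans (mem_flatsQ.1 hG).1) h)
  have : G \ insert z B = (G \ B).erase z := by
    ext e
    simp only [Finset.mem_sdiff, Finset.mem_insert, Finset.mem_erase]
    tauto
  rw [this, Finset.card_erase_of_mem (Finset.mem_sdiff.2 ⟨hzG, hzB⟩)]
  omega

/-- `|Q ∖ K| = 5` for a basis pair. -/
theorem card_insert_sdiff_eq_five (hG : G ∈ flatsQ M (5 + 1)) (hd : (gr M \ G).card = 2) (hk : kColoops M G = 1)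
    {B : Finset α} (hB : B ∈ thinMembers M 5 G) (hnP : ¬ bigP M G B) {z : α} (hz : z ∈ G \ clF M B) :
    (insert z B \ coloops M G).card = 5 := by
  have hd' : (gr M \ G).card ≤ 5 := by omega
  have hB4 := card_sdiff_eq_four_of_not_bigP hG hd hk hB hnP
  have hKB : coloops M G ⊆ B := coloops_subset_of_mem_thinMembers hG hd' hB
  have hzB : z ∉ B := fun h => (Finset.mem_sdiff.1 hz).2 (subset_clF_of_subset_gr
    ((subset_G_of_mem_thinMembers hB).trans (mem_flatsQ.1 hG).1) h)
  have hzK : z ∉ coloops M G := fun h => hzB (hKB h)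
  have : insert z B \ coloops M G = insert z (B \ coloops M G) := by
    ext e
    simp only [Finset.mem_sdiff, Finset.mem_insert]
    constructor
    · rintro ⟨h1 | h1, h2⟩
      · exact Or.inl h1
      · exact Or.inr ⟨h1, h2⟩
    · rintro (rfl | ⟨h1, h2⟩)
      · exact ⟨Or.inl rfl, hzK⟩
      · exact ⟨Or.inr h1, h2⟩
  rw [this, Finset.card_insert_of_notMem (fun h => hzB (Finset.mem_sdiff.1 h).1), hB4]

/-- **The level-`j` part of the fat count sum is at least `C(N − 1, j − 1) · fatTerm j c_j`** over the unloaded targets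
above `Q ∪ {x}`, with `c_j = 1` when `N − j ≤ 3` and `c_j = 11/18` otherwise. -/
theorem fat_count_level_ge (hG : G ∈ flatsQ M (5 + 1)) (hd : (gr M \ G).card = 2) (hk : kColoops M G = 1)
    {B : Finset α} (hB : B ∈ thinMembers M 5 G) (hnP : ¬ bigP M G B) {z : α} (hz : z ∈ G \ clF M B) {x : α}
    (hx : x ∈ G \ insert z B)
    (hload : ∀ T ∈ tgtSets M 5 G B z, x ∈ T → dload M 5 G (bigP M G) (dshGT2 M 5 G) T = 0)
    {j : ℕ} (hj : 1 ≤ j) :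
    ((((G \ insert z B).card - 1).choose (j - 1) : ℕ) : ℚ) *
      fatTerm j (if (G \ insert z B).card - j ≤ 3 then 1 else 11 / 18) ≤
      ∑ T ∈ ((tgtSets M 5 G B z).filter
        (fun T => x ∈ T ∧ dload M 5 G (bigP M G) (dshGT2 M 5 G) T = 0)).filter
        (fun T => (T \ insert z B).card = j),
        capS M 5 G T / ((221 / 360 : ℚ) * ((2 * ((T \ coloops M G).card - 2).choose 4 : ℕ) : ℚ)) := by
  have hQG : insert z B ⊆ G :=
    Finset.insert_subset (Finset.mem_sdiff.1 hz).1 (subset_G_of_mem_thinMembers hB)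
  have hd' : (gr M \ G).card ≤ 5 := by omega
  have hKQ : coloops M G ⊆ insert z B :=
    (coloops_subset_of_mem_thinMembers hG hd' hB).trans (Finset.subset_insert _ _)
  have hQ5 := card_insert_sdiff_eq_five hG hd hk hB hnP hz
  have hcount := choose_le_card_targets_level hG hB hz (Finset.singleton_subset_iff.2 hx) hj
    (by rw [Finset.card_singleton]; exact hj)
  rw [Finset.card_singleton] at hcount
  set F := ((tgtSets M 5 G B z).filter
    (fun T => x ∈ T ∧ dload M 5 G (bigP M G) (dshGT2 M 5 G) T = 0)).filter
    (fun T => (T \ insert z B).card = j) with hF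
  set c : ℚ := if (G \ insert z B).card - j ≤ 3 then 1 else 11 / 18 with hc
  have hsub : (tgtSets M 5 G B z).filter (fun T => {x} ⊆ T ∧ (T \ insert z B).card = j) ⊆ F := by
    intro T hT
    rw [Finset.mem_filter] at hT
    rw [hF, Finset.mem_filter, Finset.mem_filter]
    have hxT : x ∈ T := Finset.singleton_subset_iff.1 hT.2.1
    exact ⟨⟨hT.1, hxT, hload T hT.1 hxT⟩, hT.2.2⟩
  have hcard : ((((G \ insert z B).card - 1).choose (j - 1) : ℕ) : ℚ) ≤ (F.card : ℚ) := by
    exact_mod_cast hcount.trans (Finset.card_le_card hsub)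
  have hterm : ∀ T ∈ F, fatTerm j c ≤
      capS M 5 G T / ((221 / 360 : ℚ) * ((2 * ((T \ coloops M G).card - 2).choose 4 : ℕ) : ℚ)) := by
    intro T hT
    rw [hF, Finset.mem_filter, Finset.mem_filter] at hT
    obtain ⟨⟨hTt, -, -⟩, hTj⟩ := hT
    have hTG : T ⊆ G := subset_G_of_mem_shadowAt (mem_tgtSets.1 hTt).1
    have hQT : insert z B ⊆ T := (mem_tgtSets.1 hTt).2.1
    -- `|T ∖ K| = j + 5`
    have hTK : (T \ coloops M G).card = j + 5 := by
      have h1 : T \ coloops M G = (T \ insert z B) ∪ (insert z B \ coloops M G) := by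
        ext e
        simp only [Finset.mem_sdiff, Finset.mem_union]
        constructor
        · rintro ⟨heT, heK⟩
          by_cases heQ : e ∈ insert z B
          · exact Or.inr ⟨heQ, heK⟩
          · exact Or.inl ⟨heT, heQ⟩
        · rintro (⟨heT, heQ⟩ | ⟨heQ, heK⟩)
          · exact ⟨heT, fun h => heQ (hKQ h)⟩
          · exact ⟨hQT heQ, heK⟩
      have hdisj : Disjoint (T \ insert z B) (insert z B \ coloops M G) := by
        rw [Finset.disjoint_left]
        intro e h1 h2
        exact (Finset.mem_sdiff.1 h1).2 (Finset.mem_sdiff.1 h2).1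
      rw [h1, Finset.card_union_of_disjoint hdisj, hTj, hQ5]
    -- `|G ∖ T| = N − j`
    have hGT : (G \ T).card = (G \ insert z B).card - j := by
      have h1 : G \ insert z B = (G \ T) ∪ (T \ insert z B) := by
        ext e
        simp only [Finset.mem_sdiff, Finset.mem_union]
        constructor
        · rintro ⟨heG, heQ⟩
          by_cases heT : e ∈ T
          · exact Or.inr ⟨heT, heQ⟩
          · exact Or.inl ⟨heG, heT⟩
        · rintro (⟨heG, heT⟩ | ⟨heT, heQ⟩)
          · exact ⟨heG, fun h => heT (hQT h)⟩
          · exact ⟨hTG heT, heQ⟩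
      have hdisj : Disjoint (G \ T) (T \ insert z B) := by
        rw [Finset.disjoint_left]
        intro e h1 h2
        exact (Finset.mem_sdiff.1 h1).2 (Finset.mem_sdiff.1 h2).1
      rw [h1, Finset.card_union_of_disjoint hdisj, hTj]
      omega
    have hcap : c ≤ capS M 5 G T := by
      rw [hc]
      split_ifs with h3
      · rw [capS_eq_one_of_card_sdiff_le_three hd (by rw [hGT]; exact h3)]
      · exact capS_ge_eleven_eighteenths_two_one hd hk hTG
    unfold fatTerm
    rw [hTK, show j + 5 - 2 = j + 3 by omega]
    apply div_le_div_of_nonneg_right hcap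
    positivity
  calc ((((G \ insert z B).card - 1).choose (j - 1) : ℕ) : ℚ) * fatTerm j c
      ≤ (F.card : ℚ) * fatTerm j c := by
        apply mul_le_mul_of_nonneg_right hcard
        unfold fatTerm
        rw [hc]
        split_ifs <;> positivity
    _ = ∑ _T ∈ F, fatTerm j c := by rw [Finset.sum_const, nsmul_eq_mul]
    _ ≤ ∑ T ∈ F, capS M 5 G T /
        ((221 / 360 : ℚ) * ((2 * ((T \ coloops M G).card - 2).choose 4 : ℕ) : ℚ)) :=
        Finset.sum_le_sum hterm

/-- The fat count sum over the unloaded targets above `Q ∪ {x}` is at least the sum of its first three levels. -/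
theorem fat_count_sum_ge_levels (hG : G ∈ flatsQ M (5 + 1)) (hd : (gr M \ G).card = 2)
    {B : Finset α} {z : α} {x : α} :
    (∑ T ∈ ((tgtSets M 5 G B z).filter
        (fun T => x ∈ T ∧ dload M 5 G (bigP M G) (dshGT2 M 5 G) T = 0)).filter
        (fun T => (T \ insert z B).card = 1),
        capS M 5 G T / ((221 / 360 : ℚ) * ((2 * ((T \ coloops M G).card - 2).choose 4 : ℕ) : ℚ))) +
    (∑ T ∈ ((tgtSets M 5 G B z).filter
        (fun T => x ∈ T ∧ dload M 5 G (bigP M G) (dshGT2 M 5 G) T = 0)).filter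
        (fun T => (T \ insert z B).card = 2),
        capS M 5 G T / ((221 / 360 : ℚ) * ((2 * ((T \ coloops M G).card - 2).choose 4 : ℕ) : ℚ))) +
    (∑ T ∈ ((tgtSets M 5 G B z).filter
        (fun T => x ∈ T ∧ dload M 5 G (bigP M G) (dshGT2 M 5 G) T = 0)).filter
        (fun T => (T \ insert z B).card = 3),
        capS M 5 G T / ((221 / 360 : ℚ) * ((2 * ((T \ coloops M G).card - 2).choose 4 : ℕ) : ℚ))) ≤
    ∑ T ∈ (tgtSets M 5 G B z).filter
        (fun T => x ∈ T ∧ dload M 5 G (bigP M G) (dshGT2 M 5 G) T = 0),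
        capS M 5 G T / ((221 / 360 : ℚ) * ((2 * ((T \ coloops M G).card - 2).choose 4 : ℕ) : ℚ)) := by
  have hd' : (gr M \ G).card ≤ 5 := by omega
  set F := (tgtSets M 5 G B z).filter
    (fun T => x ∈ T ∧ dload M 5 G (bigP M G) (dshGT2 M 5 G) T = 0) with hF
  set f : Finset α → ℚ := fun T =>
    capS M 5 G T / ((221 / 360 : ℚ) * ((2 * ((T \ coloops M G).card - 2).choose 4 : ℕ) : ℚ)) with hf
  have hf0 : ∀ T ∈ F, 0 ≤ f T := fun T _ => div_nonneg (capS_nonneg' hG hd' T) (by positivity)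
  have h12 : Disjoint (F.filter (fun T => (T \ insert z B).card = 1))
      (F.filter (fun T => (T \ insert z B).card = 2)) := by
    rw [Finset.disjoint_left]
    intro T h1 h2
    rw [Finset.mem_filter] at h1 h2
    have := h1.2
    have := h2.2
    omega
  have h123 : Disjoint (F.filter (fun T => (T \ insert z B).card = 1) ∪
      F.filter (fun T => (T \ insert z B).card = 2)) (F.filter (fun T => (T \ insert z B).card = 3)) := by
    rw [Finset.disjoint_left]
    intro T h1 h2
    simp only [Finset.mem_union, Finset.mem_filter] at h1 h2
    rcases h1 with ⟨-, h1⟩ | ⟨-, h1⟩ <;> omega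
  rw [← Finset.sum_union h12, ← Finset.sum_union h123]
  apply Finset.sum_le_sum_of_subset_of_nonneg
  · intro T hT
    simp only [Finset.mem_union, Finset.mem_filter] at hT
    rcases hT with (⟨h, -⟩ | ⟨h, -⟩) | ⟨h, -⟩ <;> exact h
  · intro T hT _
    exact hf0 T hT

/-- **The numerical core**: for `N ≥ 4` the first three levels give at least `1`. -/
theorem fat_count_numeric (N : ℕ) (hN : 4 ≤ N) :
    (1 : ℚ) ≤ (((N - 1).choose 0 : ℕ) : ℚ) * fatTerm 1 (if N - 1 ≤ 3 then 1 else 11 / 18) +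
      (((N - 1).choose 1 : ℕ) : ℚ) * fatTerm 2 (if N - 2 ≤ 3 then 1 else 11 / 18) +
      (((N - 1).choose 2 : ℕ) : ℚ) * fatTerm 3 (if N - 3 ≤ 3 then 1 else 11 / 18) := by
  unfold fatTerm
  rcases Nat.lt_or_ge N 7 with h7 | h7
  · interval_cases N <;> norm_num [Nat.choose]
  · -- `N ≥ 7`: the first two levels with `capS ≥ 11/18` suffice
    have hc0 : (((N - 1).choose 0 : ℕ) : ℚ) = 1 := by simp
    have hc1 : (((N - 1).choose 1 : ℕ) : ℚ) = ((N - 1 : ℕ) : ℚ) := by simp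
    have h6 : (6 : ℚ) ≤ ((N - 1 : ℕ) : ℚ) := by exact_mod_cast (by omega : 6 ≤ N - 1)
    have hif1 : (if N - 1 ≤ 3 then (1 : ℚ) else 11 / 18) ≥ 11 / 18 := by split_ifs <;> norm_num
    have hif2 : (if N - 2 ≤ 3 then (1 : ℚ) else 11 / 18) ≥ 11 / 18 := by split_ifs <;> norm_num
    have hif3 : (if N - 3 ≤ 3 then (1 : ℚ) else 11 / 18) ≥ 11 / 18 := by split_ifs <;> norm_num
    have hpos3 : (0 : ℚ) ≤ (((N - 1).choose 2 : ℕ) : ℚ) *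
        ((if N - 3 ≤ 3 then (1 : ℚ) else 11 / 18) / ((221 / 360 : ℚ) * ((2 * (3 + 3).choose 4 : ℕ) : ℚ))) := by
      apply mul_nonneg (Nat.cast_nonneg _)
      apply div_nonneg (le_trans (by norm_num) hif3)
      positivity
    rw [hc0, hc1]
    have h1 : (11 / 18 : ℚ) / ((221 / 360 : ℚ) * ((2 * (1 + 3).choose 4 : ℕ) : ℚ)) ≤
        1 * ((if N - 1 ≤ 3 then (1 : ℚ) else 11 / 18) / ((221 / 360 : ℚ) * ((2 * (1 + 3).choose 4 : ℕ) : ℚ))) := by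
      rw [one_mul]
      apply div_le_div_of_nonneg_right hif1
      positivity
    have h2 : (6 : ℚ) * ((11 / 18 : ℚ) / ((221 / 360 : ℚ) * ((2 * (2 + 3).choose 4 : ℕ) : ℚ))) ≤
        ((N - 1 : ℕ) : ℚ) * ((if N - 2 ≤ 3 then (1 : ℚ) else 11 / 18) /
          ((221 / 360 : ℚ) * ((2 * (2 + 3).choose 4 : ℕ) : ℚ))) := by
      apply mul_le_mul h6 (div_le_div_of_nonneg_right hif2 (by positivity)) (by positivity)
        (Nat.cast_nonneg _)
    have hnum : (1 : ℚ) ≤ (11 / 18 : ℚ) / ((221 / 360 : ℚ) * ((2 * (1 + 3).choose 4 : ℕ) : ℚ)) +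
        (6 : ℚ) * ((11 / 18 : ℚ) / ((221 / 360 : ℚ) * ((2 * (2 + 3).choose 4 : ℕ) : ℚ))) := by
      norm_num [Nat.choose]
    linarith

/-- **The fat count criterion holds when no target above `Q ∪ {x}` is loaded.** -/
theorem fat_count_sum_ge_one_of_unloaded (hG : G ∈ flatsQ M (5 + 1)) (hd : (gr M \ G).card = 2)
    (hk : kColoops M G = 1) {B : Finset α} (hB : B ∈ thinMembers M 5 G) (hnP : ¬ bigP M G B) {z : α}
    (hz : z ∈ G \ clF M B) {x : α} (hx : x ∈ G \ insert z B)
    (hload : ∀ T ∈ tgtSets M 5 G B z, x ∈ T → dload M 5 G (bigP M G) (dshGT2 M 5 G) T = 0) :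
    1 ≤ ∑ T ∈ (tgtSets M 5 G B z).filter
      (fun T => x ∈ T ∧ dload M 5 G (bigP M G) (dshGT2 M 5 G) T = 0),
      capS M 5 G T / ((221 / 360 : ℚ) * ((2 * ((T \ coloops M G).card - 2).choose 4 : ℕ) : ℚ)) := by
  have hN := four_le_card_sdiff_insert hG hd hB hz
  have hl1 := fat_count_level_ge hG hd hk hB hnP hz hx hload (j := 1) (by norm_num)
  have hl2 := fat_count_level_ge hG hd hk hB hnP hz hx hload (j := 2) (by norm_num)
  have hl3 := fat_count_level_ge hG hd hk hB hnP hz hx hload (j := 3) (by norm_num)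
  have hlev := fat_count_sum_ge_levels hG hd (B := B) (z := z) (x := x)
  have hnum := fat_count_numeric (G \ insert z B).card hN
  simp only [Nat.sub_self] at hl1 hl2 hl3
  linarith

/-- **The fat case of (FAIR) when no target above `Q ∪ {x}` is loaded**: with the fat split `G ∖ clF B₀ = {w₀, x}`
of the lossy basis pair and `dload T = 0` at every target `T ∋ x`, the pair receives its fair share. -/
theorem basis_pair_fair_fat_of_unloaded (hG : G ∈ flatsQ M (5 + 1)) (hd : (gr M \ G).card = 2)
    (hk : kColoops M G = 1) (hs : ∀ e ∈ gr M, ∀ f ∈ gr M, e ≠ f → rkN M {e, f} = 2)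
    (hl : ∀ e ∈ gr M, M.Indep {e}) (hfat : (fatClosures M 5 G 2).card ≤ 1)
    {B₀ : Finset α} (hB₀ : B₀ ∈ thinMembers M 5 G) {w₀ x : α} (hD : G \ clF M B₀ = {w₀, x}) (hne : w₀ ≠ x)
    {B : Finset α} (hB : B ∈ thinMembers M 5 G) (hnP : ¬ bigP M G B) {z : α} (hz : z ∈ G \ clF M B)
    (hl0 : loss M 5 G B z ≠ 0) (hw₀ : w₀ ∈ insert z B) (hx : x ∉ insert z B)
    (hload : ∀ T ∈ tgtSets M 5 G B z, x ∈ T → dload M 5 G (bigP M G) (dshGT2 M 5 G) T = 0) :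
    loss M 5 G B z ≤ rhoL M 5 G B z * lossIncomeH M 5 G (bigP M G) (dshGT2 M 5 G) B z := by
  have hxG : x ∈ G \ insert z B := by
    refine Finset.mem_sdiff.2 ⟨?_, hx⟩
    have : x ∈ G \ clF M B₀ := by
      rw [hD]
      exact Finset.mem_insert_of_mem (Finset.mem_singleton_self _)
    exact (Finset.mem_sdiff.1 this).1
  exact basis_pair_fair_of_fat_count_sum hG hd hk hs hl hfat hB₀ hD hne hB hnP hz hl0 hw₀ hx
    (fat_count_sum_ge_one_of_unloaded hG hd hk hB hnP hz hxG hload)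

end PercRepro.Shadow
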